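import Summits.AnomalousDissipation.AnomalousDissipation.Theorems.BaireTransferRobustLoudUpgradeStubScalingLoud
import Summits.AnomalousDissipation.AnomalousDissipation.Theorems.BaireTransferRobustLoudUpgradeStubRobustCrossingClosure

/-!
# Stub `stub_scalingCrossingClosure` of the line `malkin-cone-group-orbits`
# (crux stmt-AnomalousDissipation-1144, `BaireTransfer.RobustLoudUpgrade`; companion c4
# "the viscosity unfolding", engine E′, steady)

The SCALING-CROSSING ENGINE (steady) of the companion skeleton c4.  Data: a classical steady state
`u₀` of `NS_ν(f_c)`, `ν ∈ (0,a)`, with STRICT budgets `meanEnergy < E`, `meanDissipation > ε`, and a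
real function `σ` on `P_S × ℝ` (the reduced Lyapunov–Schmidt function of the line) such that

* for every `δ > 0`, on some ball around `(c, 0)` the function `σ` is continuous and each of its
  zeros `q` yields a classical steady state of `NS_ν(f_{q.1})` within squared `H¹`-distance `δ` of
  `u₀`;
* `σ` changes sign strictly on the SHEET `(s, x) ↦ σ (s • c₁, x)`, at points `(s₁, x₁), (s₂, x₂)`
  arbitrarily close to `(1, 0)`, for forces `c₁` arbitrarily close to `c`.

Conclusion: `c ∈ closure (interior (loud S a E ε))`.  This is the engine E2 of the companion c2
(`RobustCrossingClosure.stub_robustCrossingClosure`, the case `s₁ = s₂ = 1`) with the dilation `s`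
of the force undone by the parabolic scaling of Navier–Stokes, which is free because the viscosity
is free in `LOUD`.

Proof.  (1) Intermediate level and budgets `ν < a' < a`, `meanEnergy < E' < E`,
`ε < ε' < meanDissipation`.  (2) WINDOW (`RobustCrossingClosure.exists_window` at the intermediate
data): some `δ > 0` such that every classical steady state `u'` of any `NS_ν(f_e)` with
`h1DistSq u' u₀ < δ` makes `e ∈ loud S a' E' ε'`.  (3) MARGIN (`Scaling.exists_scale_margin`): some
`κ > 0` such that for `|s - 1| < κ` the factor `α = (√s)⁻¹` has `αa' < a`, `α²E' < E`, `ε < α³ε'`.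
(4) The first hypothesis at `δ` gives a radius `r`.  (5) CLOSURE: given `θ > 0`, the sign hypothesis
at a common smallness `η ≤ θ, κ, r/4, r/(4(‖c‖ + r))` gives `c₁, s₁, s₂, x₁, x₂`; continuity of
`c' ↦ σ (sᵢ • c', xᵢ)` at `c₁` keeps the strict signs on a ball `dist c' c₁ < ρ ≤ r/4`; for such
`c'` the sheet `(s, x) ↦ (s • c', x)` maps the (convex) ball of radius `η` around `(1, 0)` into
the ball of radius `r` (sup metric: `dist (s • c') c ≤ |s - 1|‖c'‖ + dist c' c`), so the
intermediate value theorem on this connected set produces a zero `(s • c', x)` of `σ` with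
`|s - 1| < κ`, hence a `δ`-close steady state of `f_{s • c'}`, hence `s • c' ∈ loud S a' E' ε'`
by (2), hence `c' = α² • (s • c') ∈ loud S a E ε` by `Scaling.scaling_mem_loud` and (3).  Thus a
ball around `c₁` is loud, `c₁ ∈ interior loud`, and `dist c c₁ < θ`.

References: Temam, *Navier–Stokes Equations* (1979) Ch. II §1 (steady states); the vocabulary
module `Theorems/BaireTransferRobustLoudUpgradeLine.lean`; the templates
`Theorems/BaireTransferRobustLoudUpgradeStubRobustCrossingClosure.lean` (engine E2) and
`Theorems/BaireTransferRobustLoudUpgradeStubScalingLoud.lean` (scaling covariance and margin).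
-/

-- `Summit.<Summit>.<Problem>` is the tree's mandated summit-side namespace (CONVENTIONS §2); for this
-- single-conjunct summit the two coincide, so the duplicate is deliberate.
set_option linter.dupNamespace false

noncomputable section

open scoped BigOperators Topology
open Filter Set Function TopologicalSpace MeasureTheory

namespace Summit.AnomalousDissipation.AnomalousDissipation.Theorems.RobustLoudUpgrade.ScalingCrossing

open Literature.Analysis.FunctionSpaces Literature.Analysis.FunctionSpaces.Torus
open Literature.Analysis.FluidPDE
open Summit.AnomalousDissipation.AnomalousDissipation.Theses.BaireTransfer
open Summit.AnomalousDissipation.AnomalousDissipation.Theorems.RobustLoudUpgrade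

/-! ## Sup-metric bookkeeping on the sheet `(s, x) ↦ (s • c', x)` -/

/-- Sup metric on `ℝ × ℝ`: `(s, x)` lies in the ball of radius `L` around `(1, 0)` iff `|s - 1| < L`
and `|x| < L`. [folklore] -/
private lemma mem_ball_one_zero {s x L : ℝ} :
    ((s, x) : ℝ × ℝ) ∈ Metric.ball ((1 : ℝ), (0 : ℝ)) L ↔ |s - 1| < L ∧ |x| < L := by
  rw [Metric.mem_ball, Prod.dist_eq, Real.dist_eq, Real.dist_eq, sub_zero, max_lt_iff]

/-- Dilated nearby forces stay in the ball (sup metric on `P_S × ℝ`): if `dist c' c < r/2`,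
`|s - 1| < L` with `L (‖c‖ + r) ≤ r/4`, and `|x| < r`, then `dist (s • c', x) (c, 0) < r`, because
`dist (s • c') c ≤ ‖s • c' - c'‖ + dist c' c = |s - 1|‖c'‖ + dist c' c` and `‖c'‖ ≤ ‖c‖ + r`.
[folklore] -/
private lemma dist_smul_mk_lt {S : Finset (Fin 3 → ℤ)} {c c' : Coeff S} {s x r L : ℝ}
    (hr : 0 < r) (hL : L * (‖c‖ + r) ≤ r / 4) (hc' : dist c' c < r / 2) (hs : |s - 1| < L)
    (hx : |x| < r) : dist ((s • c', x) : Coeff S × ℝ) (c, (0 : ℝ)) < r := by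
  rw [Prod.dist_eq]
  show max (dist (s • c') c) (dist x 0) < r
  rw [Real.dist_eq, sub_zero]
  refine max_lt ?_ hx
  -- `‖c'‖ ≤ ‖c‖ + r`
  have hn : ‖c'‖ ≤ ‖c‖ + r := by
    have h := norm_sub_norm_le c' c
    rw [← dist_eq_norm] at h
    linarith
  -- `dist (s • c') c' = |s - 1| ‖c'‖ ≤ L (‖c‖ + r) ≤ r / 4`
  have h1 : dist (s • c') c' = |s - 1| * ‖c'‖ := by
    rw [dist_eq_norm, ← Real.norm_eq_abs, ← norm_smul, sub_smul, one_smul]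
  have h2 : |s - 1| * ‖c'‖ ≤ L * (‖c‖ + r) :=
    mul_le_mul hs.le hn (norm_nonneg _) ((abs_nonneg _).trans hs.le)
  calc dist (s • c') c ≤ dist (s • c') c' + dist c' c := dist_triangle _ _ _
    _ < r / 4 + r / 2 := by
        rw [h1]
        exact add_lt_add_of_le_of_lt (h2.trans hL) hc'
    _ < r := by linarith

/-! ## The stub -/

/-- **Scaling crossing ⇒ closure of the loud interior** (registered stub
`stub_scalingCrossingClosure` of the line `malkin-cone-group-orbits`, companion c4, engine E′,
steady).  If the reduced function `σ` is continuous near `(c, 0)` with zeros giving `H¹`-close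
classical steady states (for every closeness `δ`), and `σ` changes sign strictly on the sheet
`(s, x) ↦ σ (s • c₁, x)` near `(1, 0)` at forces `c₁` arbitrarily close to `c`, then
`c ∈ closure (interior (loud S a E ε))`: the strict sign change persists for `c'` near `c₁`, the
intermediate value theorem on the (connected) sheet gives a zero
`(s • c', x)` of `σ`, hence a steady state of `f_{s • c'}` inside the budget window of `u₀` at
intermediate data `(a', E', ε')`, so `s • c'` is loud there, and the parabolic scaling by
`α = (√s)⁻¹` (inside the scaling margin) makes `c' = α² • (s • c')` loud at `(a, E, ε)`; so a ball
around `c₁` is loud. [folklore] -/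
theorem stub_scalingCrossingClosure : ∀ (S : Finset (Fin 3 → ℤ)) (a E ε : ℝ) (c : Coeff S) (ν : ℝ) (u₀ : UnitAddTorus (Fin 3) → EuclideanSpace ℝ (Fin 3)) (p₀ : UnitAddTorus (Fin 3) → ℝ) (σ : Coeff S × ℝ → ℝ), 0 < ν → ν < a → Torus.IsSteadyNSState ν (force S c) u₀ p₀ → meanEnergy (fun _ : ℝ => u₀) < E → ε < meanDissipation ν (fun _ : ℝ => u₀) → (∀ δ : ℝ, 0 < δ → ∃ r : ℝ, 0 < r ∧ ContinuousOn σ (Metric.ball (c, (0 : ℝ)) r) ∧ ∀ q ∈ Metric.ball (c, (0 : ℝ)) r, σ q = 0 → ∃ (u' : UnitAddTorus (Fin 3) → EuclideanSpace ℝ (Fin 3)) (p' : UnitAddTorus (Fin 3) → ℝ), Torus.IsSteadyNSState ν (force S q.1) u' p' ∧ h1DistSq u' u₀ < δ) → (∀ η : ℝ, 0 < η → ∃ (c₁ : Coeff S) (s₁ s₂ x₁ x₂ : ℝ), dist c₁ c < η ∧ |s₁ - 1| < η ∧ |s₂ - 1| < η ∧ |x₁| < η ∧ |x₂| < η ∧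 σ (s₁ • c₁, x₁) < 0 ∧ 0 < σ (s₂ • c₁, x₂)) → c ∈ closure (interior (loud S a E ε)) := by
  -- adapted from Theorems/BaireTransferRobustLoudUpgradeStubRobustCrossingClosure.lean
  -- `stub_robustCrossingClosure` (engine E2: the case `s₁ = s₂ = 1`)
  intro S a E ε c ν u₀ p₀ σ hν hνa hst hE hε hzero hcross
  have hsm₀ : IsSmooth u₀ := hst.smooth_velocity.isSmooth_slice (Set.mem_univ (0 : ℝ))
  -- (1) intermediate level and budgets, strictly inside the slack
  obtain ⟨a', hνa', ha'a⟩ : ∃ a' : ℝ, ν < a' ∧ a' < a := ⟨(ν + a) / 2, by linarith, by linarith⟩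
  obtain ⟨E', hE', hE'E⟩ : ∃ E' : ℝ, meanEnergy (fun _ : ℝ => u₀) < E' ∧ E' < E :=
    ⟨(meanEnergy (fun _ : ℝ => u₀) + E) / 2, by linarith, by linarith⟩
  obtain ⟨ε', hεε', hε'⟩ : ∃ ε' : ℝ, ε < ε' ∧ ε' < meanDissipation ν (fun _ : ℝ => u₀) :=
    ⟨(ε + meanDissipation ν (fun _ : ℝ => u₀)) / 2, by linarith, by linarith⟩
  -- (2) the budget window of `u₀` at the intermediate data
  obtain ⟨δ, hδ0, hwin⟩ := RobustCrossingClosure.exists_window (S := S) hν hνa' hsm₀ hE' hε'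
  -- (3) the scaling margin
  obtain ⟨κ, hκ, hmargin⟩ := Scaling.exists_scale_margin ha'a hE'E hεε'
  -- (4) on a ball around `(c, 0)`, `σ` is continuous and its zeros give `δ`-close steady states
  obtain ⟨r, hr, hcont, hz⟩ := hzero δ hδ0
  -- the admissible size of dilations: `L (‖c‖ + r) ≤ r / 4`
  have hM : 0 < ‖c‖ + r := add_pos_of_nonneg_of_pos (norm_nonneg _) hr
  obtain ⟨L, hL, hLM⟩ : ∃ L : ℝ, 0 < L ∧ L * (‖c‖ + r) ≤ r / 4 :=
    ⟨r / (4 * (‖c‖ + r)), div_pos hr (mul_pos (by norm_num) hM),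
      le_of_eq (by rw [div_mul_eq_mul_div, mul_div_mul_right _ _ hM.ne'])⟩
  -- (5) closure
  rw [Metric.mem_closure_iff]
  intro θ hθ
  -- a common smallness `η ≤ θ, κ, L, r / 4`
  obtain ⟨η, hη, hηθ, hηκ, hηL, hηr⟩ : ∃ η : ℝ, 0 < η ∧ η ≤ θ ∧ η ≤ κ ∧ η ≤ L ∧ η ≤ r / 4 :=
    ⟨min (min θ κ) (min L (r / 4)), lt_min (lt_min hθ hκ) (lt_min hL (by linarith)),
      (min_le_left _ _).trans (min_le_left _ _), (min_le_left _ _).trans (min_le_right _ _),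
      (min_le_right _ _).trans (min_le_left _ _), (min_le_right _ _).trans (min_le_right _ _)⟩
  have hηr' : η ≤ r := hηr.trans (by linarith)
  obtain ⟨c₁, s₁, s₂, x₁, x₂, hc₁, hs₁, hs₂, hx₁, hx₂, hσ₁, hσ₂⟩ := hcross η hη
  have hc₁r : dist c₁ c < r / 4 := hc₁.trans_le hηr
  have hc₁r' : dist c₁ c < r / 2 := hc₁r.trans (by linarith)
  -- `c' ↦ σ (s • c', x)` is continuous at `c₁` whenever `|s - 1| < η`, `|x| < η`
  have hat : ∀ s x : ℝ, |s - 1| < η → |x| < η →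
      ContinuousAt (fun c' : Coeff S => σ (s • c', x)) c₁ := by
    intro s x hs hx
    have hmem : ((s • c₁, x) : Coeff S × ℝ) ∈ Metric.ball (c, (0 : ℝ)) r :=
      Metric.mem_ball.2 (dist_smul_mk_lt hr hLM hc₁r' (hs.trans_le hηL) (hx.trans_le hηr'))
    have hca : ContinuousAt σ (s • c₁, x) := hcont.continuousAt (Metric.isOpen_ball.mem_nhds hmem)
    have hf : Continuous fun c' : Coeff S => ((s • c', x) : Coeff S × ℝ) := by fun_prop
    exact ContinuousAt.comp' (f := fun c' : Coeff S => ((s • c', x) : Coeff S × ℝ)) (x := c₁) hca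
      hf.continuousAt
  -- the strict signs persist on a ball around `c₁`
  have h₁ : ∀ᶠ c' in 𝓝 c₁, σ (s₁ • c', x₁) < 0 :=
    Filter.Tendsto.eventually_lt_const hσ₁ (hat s₁ x₁ hs₁ hx₁)
  have h₂ : ∀ᶠ c' in 𝓝 c₁, 0 < σ (s₂ • c', x₂) :=
    Filter.Tendsto.eventually_const_lt hσ₂ (hat s₂ x₂ hs₂ hx₂)
  obtain ⟨ρ', hρ', hρ'σ⟩ := Metric.eventually_nhds_iff.1 (h₁.and h₂)
  obtain ⟨ρ, hρ, hρρ', hρr⟩ : ∃ ρ : ℝ, 0 < ρ ∧ ρ ≤ ρ' ∧ ρ ≤ r / 4 :=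
    ⟨min ρ' (r / 4), lt_min hρ' (by linarith), min_le_left _ _, min_le_right _ _⟩
  -- the ball of radius `ρ` around `c₁` is loud
  have hsub : Metric.ball c₁ ρ ⊆ loud S a E ε := by
    intro c' hc'
    rw [Metric.mem_ball] at hc'
    have hc'r : dist c' c < r / 2 :=
      calc dist c' c ≤ dist c' c₁ + dist c₁ c := dist_triangle _ _ _
        _ < r / 4 + r / 4 := add_lt_add (hc'.trans_le hρr) hc₁r
        _ = r / 2 := by ring
    obtain ⟨hneg, hpos⟩ := hρ'σ (hc'.trans_le hρρ')
    -- the sheet of `c'` maps the ball of radius `η` around `(1, 0)` into the ball of radius `r`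
    have hmaps : Set.MapsTo (fun p : ℝ × ℝ => ((p.1 • c', p.2) : Coeff S × ℝ))
        (Metric.ball ((1 : ℝ), (0 : ℝ)) η) (Metric.ball (c, (0 : ℝ)) r) := by
      rintro ⟨s, x⟩ hp
      obtain ⟨hs, hx⟩ := mem_ball_one_zero.1 hp
      exact Metric.mem_ball.2
        (dist_smul_mk_lt hr hLM hc'r (hs.trans_le hηL) (hx.trans_le hηr'))
    have hf : Continuous fun p : ℝ × ℝ => ((p.1 • c', p.2) : Coeff S × ℝ) := by fun_prop
    have hcont' : ContinuousOn (fun p : ℝ × ℝ => σ (p.1 • c', p.2))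
        (Metric.ball ((1 : ℝ), (0 : ℝ)) η) :=
      hcont.comp hf.continuousOn hmaps
    -- intermediate value theorem on the (convex, hence connected) ball of the sheet
    have hp₁ : ((s₁, x₁) : ℝ × ℝ) ∈ Metric.ball ((1 : ℝ), (0 : ℝ)) η :=
      mem_ball_one_zero.2 ⟨hs₁, hx₁⟩
    have hp₂ : ((s₂, x₂) : ℝ × ℝ) ∈ Metric.ball ((1 : ℝ), (0 : ℝ)) η :=
      mem_ball_one_zero.2 ⟨hs₂, hx₂⟩
    have hmem0 : (0 : ℝ) ∈ Set.Icc (σ (s₁ • c', x₁)) (σ (s₂ • c', x₂)) := ⟨hneg.le, hpos.le⟩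
    obtain ⟨⟨s, x⟩, hpx, hσ0⟩ :=
      (convex_ball ((1 : ℝ), (0 : ℝ)) η).isPreconnected.intermediate_value hp₁ hp₂ hcont' hmem0
    obtain ⟨hs, -⟩ := mem_ball_one_zero.1 hpx
    -- a `δ`-close steady state of `f_{s • c'}`: `s • c'` is loud at the intermediate data
    obtain ⟨u', p', hst', hdist⟩ := hz _ (hmaps hpx) hσ0
    have hloud : s • c' ∈ loud S a' E' ε' := hwin (s • c') u' p' hst' hdist
    -- undo the dilation by the parabolic scaling with `α = (√s)⁻¹`, inside the margin
    obtain ⟨hs0, hα0, hαa, hαE, hαε⟩ := hmargin s (hs.trans_le hηκ)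
    have key : (Real.sqrt s)⁻¹ ^ 2 • s • c' ∈ loud S a E ε :=
      Scaling.scaling_mem_loud S a a' E E' ε ε' (Real.sqrt s)⁻¹ (s • c') hloud hα0 hαa.le hαE.le
        hαε.le
    rwa [Scaling.inv_sqrt_sq_smul_smul hs0 c'] at key
  refine ⟨c₁, interior_maximal hsub Metric.isOpen_ball (Metric.mem_ball_self hρ), ?_⟩
  rw [dist_comm]
  exact hc₁.trans_le hηθ

end Summit.AnomalousDissipation.AnomalousDissipation.Theorems.RobustLoudUpgrade.ScalingCrossing

end
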